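import Summits.BirchSwinnertonDyer.BirchSwinnertonDyer.Theses.PAdicOrderV2
import Literature.NumberTheory.EllipticCurves.SelmerCorankControl
import Literature.NumberTheory.EllipticCurves.IwasawaSelmerControlAwayFromPProofs
import Literature.NumberTheory.EllipticCurves.SelmerCorankControlRatOrdinaryProofs

/-!
# Stub CT of line `Sketch` for crux #2 `PAdicOrderComparisonR2` (stmt-BirchSwinnertonDyer-0489):
# Mazur's control theorem in corank form

For `E/ℚ` with globally minimal model `W`, a prime `p` of good ordinary reduction, the cyclotomic
`ℤ_p`-extension `κ` with topological generator `γ` and any Pontryagin-dual datum `D`,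
`rank_{ℤ_p} X/TX = corank_{ℤ_p} Sel_{p^∞}(E/ℚ)` — binder for binder the rank clause of the named
fact `Literature.NumberTheory.EllipticCurves.Greenberg1999_coinvariantsRank_eq_selmerCorank_rat`
(R. Greenberg, *Iwasawa theory for elliptic curves*, LNM 1716 (1999), Thm. 1.2 and §1 p. 65;
B. Mazur, Invent. Math. 18 (1972), §6), which is now a tree THEOREM:
`Greenberg1999_coinvariantsRank_eq_selmerCorank_rat_holds`
(`SelmerCorankControlRatOrdinaryProofs`: Greenberg's Lemma 3.4 at the layer `n = 0` —
the `p`-power torsion of `ker (H¹(ℚ_p, E) → H¹(ℚ_{p,∞}, E))` is finite — assembled from the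
Kummer-theoretic skeleton, the ordinary filtration, a Frobenius fixing `μ_{p^∞}` and the
Weil-pairing scalar bound, then `Greenberg1999_coinvariantsRank_eq_selmerCorank_rat_of_ordinary_local_finiteness`'s
route through Lemmas 3.2, 3.3, 3.5 at `n = 0`).
-/

-- The directory layout `Summits/BirchSwinnertonDyer/BirchSwinnertonDyer/…` forces the duplicated segment.
set_option linter.dupNamespace false

namespace Summit.BirchSwinnertonDyer.BirchSwinnertonDyer.Theorems

open Literature.NumberTheory.EllipticCurves

/-- **Stub CT (Mazur's control theorem in corank form).** For `E/ℚ` with globally minimal model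
`W`, good ordinary reduction at `p` (`W.HasGoodReductionAtPrime p`, `p ∤ a_p`), the cyclotomic
`ℤ_p`-extension `κ` with topological generator `γ` and any dual datum `D`:
`rank_{ℤ_p} X/TX = corank_{ℤ_p} Sel_{p^∞}(E/ℚ)` — the rank clause of the tree theorem
`Greenberg1999_coinvariantsRank_eq_selmerCorank_rat_holds` (Greenberg, LNM 1716, Thm. 1.2, §1
p. 65, §3 Lemma 3.4 p. 89; Mazur 1972, §6). [cite: GreenbergLNM1716, Thm. 1.2 and §3 Lemma 3.4 (p. 89)] -/
theorem stub_control :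
    ∀ (W : WeierstrassCurve ℚ) [W.IsElliptic] [W.IsGloballyMinimal] (p : ℕ) [Fact p.Prime],
      W.HasGoodReductionAtPrime p → ¬ (p : ℤ) ∣ W.frobeniusTrace p →
      ∀ (κ : Literature.NumberTheory.EllipticCurves.ZpExtension ℚ p) (γ : Field.absoluteGaloisGroup ℚ),
        κ.IsCyclotomic → κ.IsTopGenerator γ →
      ∀ (D : W.SelmerDualData κ γ),
        Literature.NumberTheory.EllipticCurves.IwasawaAlgebra.coinvariantsRank p D.X = W.selmerCorank p :=
  fun W _ _ p _ hgood hord κ γ hκ hγ D =>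
    (Greenberg1999_coinvariantsRank_eq_selmerCorank_rat_holds W p hgood hord κ γ hκ hγ D).2

end Summit.BirchSwinnertonDyer.BirchSwinnertonDyer.Theorems
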